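import Literature.MathematicalPhysics.QuantumFieldTheory.Balaban1983to89.T3DescentFibreTower
import Literature.MathematicalPhysics.QuantumFieldTheory.Balaban1983to89.BlockAveragingSection
import HarnessLib

/-!
# `Balaban1983to89.T3DescentSection` — rung R3, crux K1, child «MinimiserStability»: the descent `D_{n,K}` of the d = 3 family is
# SURJECTIVE at the printed smearing, every fibre of `T3ConstrainedMinimiser` is nonempty, and the fibre tower of the constrained
# minimal action holds unconditionally

Cell `ym3-torus` (HUMAN RULING D-0037, YM ladder rung R3), seat `ym3-torus-p1` gen 4; closes gap G-K1a-4 of the cell record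
HOME/UV3-NODE.md §11.  WHAT THIS IS NOT: no estimate — elementary consequences of the explicit section of one block averaging
(`BlockAveragingSection.faceSec`, `surjective_blockAvg`) for the iterated, level-shifted descent `T3TiltDescent.descendTo` and the
objects `fibre` / `minAction` of `T3ConstrainedMinimiser` (p408691).

* `iter_surjective` — an iterate of surjective averagings is surjective; `descendTo_surjective` — `D_{n,K}` is onto for every
  small-loop average with `ℰ(1,…,1) = 1` (the printed `exp[mean log]` = `ℰp`: `T3DescentFibreTower.expMeanLogSU_E_one`);
* `fibre_nonempty` — every fibre `{U : D_{n,K}U = V}` is nonempty, so `minAction V = inf` over a NONEMPTY set (never the junk value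
  `sInf ∅ = 0`) and `minAction V ≤ A(U)` is witnessed; `exists_lt_minAction_add` — near-minimisers exist;
* `minAction_tower_ℰp` — `minAction_{n,K'}(V) = inf_{W ∈ fibre_{n,K}(V)} minAction_{K,K'}(W)` with NO surjectivity hypothesis at `ℰp`
  (and at every `ℰ` with `ℰ(1,…,1) = 1`).

References: T. Bałaban, CMP 109 (1987) 249 [Balaban1987RG1] ((0.4), (0.11) p.253); CMP 102 (1985) 255 [Balaban1985UV3] ((41)–(42)
p.266: the nested constrained variational problems).
-/

noncomputable section

open Literature.MathematicalPhysics.QuantumFieldTheory.Balaban1983to89.T3ContinuumYM3Torus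
open Literature.MathematicalPhysics.QuantumFieldTheory.Balaban1983to89.T3LevelShift
open Literature.MathematicalPhysics.QuantumFieldTheory.Balaban1983to89.T3UnitLawDensityEML (ℰp)
open Literature.MathematicalPhysics.QuantumFieldTheory.Balaban1983to89.T3TiltDescent
open Literature.MathematicalPhysics.QuantumFieldTheory.Balaban1983to89.T3ConstrainedMinimiser
open Literature.MathematicalPhysics.QuantumFieldTheory.Balaban1983to89.T3DescentFibreTower
open Literature.MathematicalPhysics.QuantumFieldTheory.Balaban1983to89.BlockAveragingSection

namespace Literature.MathematicalPhysics.QuantumFieldTheory.Balaban1983to89.T3DescentSection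

/-! ## §1 Iterates of surjective averagings; the descent is onto -/

section Surj

variable {P : Params} {G : Type*} [GaugeGroup G]

/-- An iterate of one-step averagings all of which are surjective is surjective. [cite: Balaban1987RG1, (0.11) p.253] -/
theorem iter_surjective (av : ∀ j, Averaging P j G) :
    ∀ k : ℕ, (∀ i, i < k → Function.Surjective (av i).avg) → Function.Surjective (Averaging.iter av k)
  | 0, _ => fun U => ⟨U, rfl⟩
  | k + 1, h => fun W => by
    obtain ⟨W', hW'⟩ := h k (Nat.lt_succ_self k) W
    obtain ⟨U, hU⟩ := iter_surjective av k (fun i hi => h i (Nat.lt_succ_of_lt hi)) W'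
    exact ⟨U, by show (av k).avg (Averaging.iter av k U) = W; rw [hU, hW']⟩

/-- `k` (0.4)-averagings from the finest lattice of a `Params` with `k ≤ m + K` form a surjective map, for every small-loop average
with `ℰ(1,…,1) = 1`. [cite: Balaban1987RG1, (0.4)/(0.11) p.253] -/
theorem iter_blockAvg_surjective (ℰ : LoopAverage G) (hE : ∀ n : ℕ, ℰ.E (fun _ : Fin (n + 1) => (1 : G)) = 1) {k : ℕ}
    (hk : k ≤ P.m + P.K) :
    Function.Surjective (Averaging.iter (fun i => BlockAveraging.blockAvg (P := P) (j := i) ℰ) k) :=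
  iter_surjective _ k fun i hi => surjective_blockAvg (by omega) ℰ hE

variable (F : T3Family) (ℰ : LoopAverage G)

/-- **THE DESCENT `D_{n,K}` IS ONTO** (`n ≤ K`): every configuration of the `n`-th approximation's finest lattice is the `(K−n)`-fold
block average of a configuration of the `K`-th approximation, for every small-loop average with `ℰ(1,…,1) = 1`. [cite: Balaban1987RG1, (0.11) p.253] -/
theorem descendTo_surjective (hE : ∀ n : ℕ, ℰ.E (fun _ : Fin (n + 1) => (1 : G)) = 1) {n K : ℕ} (h : n ≤ K) :
    Function.Surjective (descendTo F ℰ n K h : GaugeField (F.P K) 0 G → GaugeField (F.P n) 0 G) := by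
  intro V
  have hk : K - n ≤ (F.PP F.m K).m + (F.PP F.m K).K := by show K - n ≤ F.m + K; omega
  obtain ⟨U, hU⟩ := iter_blockAvg_surjective (P := F.PP F.m K) ℰ hE hk
    (fieldShift (F.sitesPerDir_eq (m := F.m) (K := K) (j := K - n) (m' := F.m) (K' := n) (j' := 0) (by omega)) V)
  refine ⟨U, ?_⟩
  show fieldShift _ (Averaging.iter (fun i => BlockAveraging.blockAvg (P := F.PP F.m K) (j := i) ℰ) (K - n) U) = V
  rw [hU, fieldShift_fieldShift]
  exact fieldShift_refl _ _

/-- Hence **EVERY FIBRE IS NONEMPTY**. [cite: Balaban1985UV3, (41) p.266] -/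
theorem fibre_nonempty (hE : ∀ n : ℕ, ℰ.E (fun _ : Fin (n + 1) => (1 : G)) = 1) {n K : ℕ} (h : n ≤ K)
    (V : GaugeField (F.P n) 0 G) : (fibre F ℰ n K h V).Nonempty :=
  descendTo_surjective F ℰ hE h V

/-- So the action values over a fibre form a nonempty set bounded below, and NEAR-MINIMISERS EXIST: for every `ε > 0` some `U` in the
fibre has `A(U) < minAction V + ε`. [cite: Balaban1985UV3, (41) p.266] -/
theorem exists_lt_minAction_add (hE : ∀ n : ℕ, ℰ.E (fun _ : Fin (n + 1) => (1 : G)) = 1) {n K : ℕ} (h : n ≤ K)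
    (V : GaugeField (F.P n) 0 G) {ε : ℝ} (hε : 0 < ε) :
    ∃ U ∈ fibre F ℰ n K h V, wilsonAction4 U < minAction F ℰ n K h V + ε := by
  have hne : ((fun U => wilsonAction4 U) '' fibre F ℰ n K h V).Nonempty := (fibre_nonempty F ℰ hE h V).image _
  obtain ⟨_, ⟨U, hU, rfl⟩, hlt⟩ := Real.lt_sInf_add_pos hne hε
  exact ⟨U, hU, hlt⟩

/-- **THE FIBRE TOWER, UNCONDITIONALLY** (every `ℰ` with `ℰ(1,…,1) = 1`): `minAction_{n,K'}(V) = inf {minAction_{K,K'}(W) : W ∈ fibre_{n,K}(V)}`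
(`T3DescentFibreTower.minAction_tower` with its surjectivity hypothesis discharged by `fibre_nonempty`). [cite: Balaban1985UV3, (41)-(42) p.266] -/
theorem minAction_tower_of_E_one (hE : ∀ n : ℕ, ℰ.E (fun _ : Fin (n + 1) => (1 : G)) = 1) {n K K' : ℕ} (h₁ : n ≤ K)
    (h₂ : K ≤ K') (V : GaugeField (F.P n) 0 G) :
    minAction F ℰ n K' (h₁.trans h₂) V = sInf ((fun W => minAction F ℰ K K' h₂ W) '' fibre F ℰ n K h₁ V) :=
  minAction_tower F ℰ h₁ h₂ (fibre_nonempty F ℰ hE h₂) V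

end Surj

/-! ## §2 At the printed smearing `ℰp = exp[mean log]` on `SU(2)` -/

section Printed

variable (F : T3Family)

/-- `D_{n,K}` is onto at the printed smearing. [cite: Balaban1987RG1, (0.4)/(0.11) p.253] -/
theorem descendTo_surjective_ℰp {n K : ℕ} (h : n ≤ K) :
    Function.Surjective (descendTo F ℰp n K h :
      GaugeField (F.P K) 0 (Matrix.specialUnitaryGroup (Fin 2) ℂ) → GaugeField (F.P n) 0 (Matrix.specialUnitaryGroup (Fin 2) ℂ)) :=
  descendTo_surjective F ℰp expMeanLogSU_E_one h

/-- Every fibre of the route's constrained variational problems is nonempty. [cite: Balaban1985UV3, (41) p.266] -/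
theorem fibre_nonempty_ℰp {n K : ℕ} (h : n ≤ K) (V : GaugeField (F.P n) 0 (Matrix.specialUnitaryGroup (Fin 2) ℂ)) :
    (fibre F ℰp n K h V).Nonempty :=
  fibre_nonempty F ℰp expMeanLogSU_E_one h V

/-- **THE FIBRE TOWER AT THE PRINTED SMEARING, hypothesis-free** — the form the child «MinimiserStability» of K1 uses (`K' = K + 1`:
the two-cut-off comparison of `MinimiserStabilityAt` is a one-step statement along the `(n,K)`-fibre). [cite: Balaban1985UV3, (41)-(42) p.266] -/
theorem minAction_tower_ℰp {n K K' : ℕ} (h₁ : n ≤ K) (h₂ : K ≤ K')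
    (V : GaugeField (F.P n) 0 (Matrix.specialUnitaryGroup (Fin 2) ℂ)) :
    minAction F ℰp n K' (h₁.trans h₂) V = sInf ((fun W => minAction F ℰp K K' h₂ W) '' fibre F ℰp n K h₁ V) :=
  minAction_tower_of_E_one F ℰp expMeanLogSU_E_one h₁ h₂ V

end Printed

end Literature.MathematicalPhysics.QuantumFieldTheory.Balaban1983to89.T3DescentSection

end
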